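import Literature.NumberTheory.LFunctions.Zhang2022.Section9Ded97
import Literature.NumberTheory.LFunctions.Zhang2022.Section8cStatements
import HarnessLib

/-!
# Zhang (2022) §9 p. 51: the two applications of Lemmas 8.2/8.4 at `x = P₃/(dr)` with the SHARP
# error `O(𝓛⁻¹⁵)` (inputs of `Z22:§9.u004`)

Y. Zhang, *Discrete mean estimates and the Landau–Siegel zero*, arXiv:2211.02515v1 (2022)
[Zhang2022LandauSiegel] — **an unrefereed manuscript under adjudication; nothing here asserts anything about
its Theorems 1–2 or about Landau–Siegel zeros.** Campaign cell `siegel-zhang` (D-0069), discharge seat d17,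
cone leaf C23 (`Skeleton.Ded97`). The typed nodes `Section9Statements.Step9u002/Step9u003` carry the printed
error `O(𝓛⁻⁶)` (tex L2607, L2611) — literally correct (discharged as implications from Lemmas 8.2/8.4 in
`Section9Ded97`) but WEAKER than the main terms they accompany (`L′(1,χ)/log P₃ ≍ 𝓛⁻⁷`): the §9
gathering needs the `O(𝓛⁻⁶)/log P₃ = O(𝓛⁻¹⁵)` that the same derivation gives (and that §8 prints,
tex L2422–L2434). This file records the sharp forms `step9u002_sharp`, `step9u003_sharp` (same proofs as
`ded9u002_holds`, `ded9u003_holds`, keeping the factor `1/log P₃ = 1/(0.498𝓛⁹)`). Theorem-only; no new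
definition or fact.

## References

* Y. Zhang, arXiv:2211.02515v1 (2022), §9 p. 51; §8 Lemmas 8.2, 8.4 pp. 45–46, p. 47.
  [cite: Zhang2022LandauSiegel, §9 p.51]
-/

noncomputable section

open Complex Real ComplexConjugate

namespace Literature.NumberTheory.LFunctions.Zhang2022.Section9Discharge

open Skeleton Section9Statements

/-- Eventually `log D ≥ L₀`. [cite: Zhang2022LandauSiegel, §2 p.4] -/
private theorem forAllLarge_log_ge'' (L₀ : ℝ) : ForAllLarge fun D _ _ => L₀ ≤ Real.log D := by
  refine ForAllLarge.of_le ⌈Real.exp L₀⌉₊ fun D _ χ hD _ _ => ?_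
  have hexp : Real.exp L₀ ≤ D := le_trans (Nat.le_ceil _) (by exact_mod_cast hD)
  exact (Real.le_log_iff_exp_le (lt_of_lt_of_le (Real.exp_pos _) hexp)).mpr hexp

/-- `T > 0`. [cite: Zhang2022LandauSiegel, §6] -/
private theorem bigT_pos' (D : ℕ) : 0 < bigT D := Real.exp_pos _

/-- `P₂, P₃ > 0`. [cite: Zhang2022LandauSiegel, §2 (2.21)] -/
private theorem P2_pos_P3_pos' (D : ℕ) : 0 < Skeleton.P2 D ∧ 0 < P3 D :=
  ⟨div_pos (Real.rpow_pos_of_pos (Real.exp_pos _) _) (pow_pos (Real.exp_pos _) _),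
    Real.rpow_pos_of_pos (Real.exp_pos _) _⟩

/-- `log P₃ = 0.498𝓛⁹`. [cite: Zhang2022LandauSiegel, §2 (2.21)] -/
private theorem log_P3' {D : ℕ} : Real.log (P3 D) = 0.498 * ell D ^ 9 := by
  have hP : 0 < bigP D := Real.exp_pos _
  rw [P3, Real.log_rpow hP, log_bigP]

/-- For `𝓛 ≥ 2`: `1 < P`, `P₃ < P`, `P₃ ≤ PT⁻²`, `1 ≤ log P₃`. [cite: Zhang2022LandauSiegel, §2 (2.6), (2.21)] -/
private theorem P3_facts' {D : ℕ} (hD : 2 ≤ Real.log D) :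
    1 < bigP D ∧ P3 D < bigP D ∧ P3 D ≤ bigP D / bigT D ^ 2 ∧ 1 ≤ Real.log (P3 D) := by
  have hℓ : 2 ≤ ell D := by rw [ell]; exact hD
  have hP : 1 < bigP D := by
    rw [bigP]; exact Real.one_lt_exp_iff.mpr (by positivity)
  refine ⟨hP, ?_, (P3_le_P1 D).trans (P1_le_P_div_T_sq D hD), ?_⟩
  · rw [P3]
    conv_rhs => rw [← Real.rpow_one (bigP D)]
    exact Real.rpow_lt_rpow_of_exponent_lt hP (by norm_num)
  · rw [log_P3']
    have : (2:ℝ) ^ 9 ≤ ell D ^ 9 := pow_le_pow_left₀ (by norm_num) hℓ 9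
    nlinarith


/-- `β_μ` at `μ = 7` is `β₇`. [cite: Zhang2022LandauSiegel, §2 (2.22)] -/
private theorem betaMu_seven' (D : ℕ) : betaMu D 7 = beta7 D := by simp [betaMu]

/-- The summand identity behind "By Lemma 8.2 … with `x = P₂/dr`": for `1 ≤ m < y = P₂/(dr)`,
`χ(m)ϰ₂(drm)m^{−(1−β_j)} = (log P₂)⁻¹ · χ(m)m^{−(1−β_j)}(y/m)^{β₇}log(y/m)`.
[cite: Zhang2022LandauSiegel, §8 (8.6) p.44, p.47 tex L2424] -/
theorem vk2_summand_eq (c' : ℝ) {D : ℕ} [NeZero D] (χ : DirichletCharacter ℂ D) (j : ℕ) {d r m : ℕ}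
    (hdr : 0 < ((d * r : ℕ) : ℝ)) (hm : 1 ≤ m) (hP2 : Real.log (Skeleton.P2 D) ≠ 0)
    (hmy : (m : ℝ) < Skeleton.P2 D / ((d * r : ℕ) : ℝ)) :
    χ (m : ZMod D) * vk2 D (d * r * m) / (m : ℂ) ^ (1 - betaJ c' D j) =
      (Real.log (Skeleton.P2 D) : ℂ)⁻¹ *
        (χ (m : ZMod D) / (m : ℂ) ^ (1 - betaJ c' D j) *
          ((Skeleton.P2 D / ((d * r : ℕ) : ℝ) / m : ℝ) : ℂ) ^ betaMu D 7 *
          (Real.log (Skeleton.P2 D / ((d * r : ℕ) : ℝ) / m) : ℂ)) := by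
  have hm0 : (0 : ℝ) < m := by exact_mod_cast hm
  have hP2pos : 0 < Skeleton.P2 D := (P2_pos_P3_pos' D).1
  have hcast : ((d * r * m : ℕ) : ℝ) = ((d * r : ℕ) : ℝ) * m := by push_cast; ring
  have hlt : ((d * r * m : ℕ) : ℝ) < Skeleton.P2 D := by
    rw [hcast]; rwa [lt_div_iff₀ hdr, mul_comm] at hmy
  have hdrm : 0 < ((d * r * m : ℕ) : ℝ) := by rw [hcast]; positivity
  have hq : Skeleton.P2 D / ((d * r * m : ℕ) : ℝ) = Skeleton.P2 D / ((d * r : ℕ) : ℝ) / m := by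
    rw [hcast, div_div]
  have hlog : 1 - Real.log ((d * r * m : ℕ) : ℝ) / Real.log (Skeleton.P2 D) =
      Real.log (Skeleton.P2 D / ((d * r : ℕ) : ℝ) / m) / Real.log (Skeleton.P2 D) := by
    rw [← hq, Real.log_div hP2pos.ne' hdrm.ne']
    field_simp
  rw [vk2, if_pos hlt, hlog, hq, betaMu_seven']
  have hL : (Real.log (Skeleton.P2 D) : ℂ) ≠ 0 := by exact_mod_cast hP2
  push_cast
  field_simp

/-- For `𝓛 ≥ 4`: `1 < P`, `P₂ < P`, `P₂ ≤ PT⁻²`, `1 ≤ log P₂` and `0.498𝓛⁹ ≤ log P₂`.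
[cite: Zhang2022LandauSiegel, §2 (2.6), (2.21)] -/
private theorem P2_facts' {D : ℕ} (hD : 4 ≤ Real.log D) :
    1 < bigP D ∧ Skeleton.P2 D < bigP D ∧ Skeleton.P2 D ≤ bigP D / bigT D ^ 2 ∧
      1 ≤ Real.log (Skeleton.P2 D) ∧ 0.498 * ell D ^ 9 ≤ Real.log (Skeleton.P2 D) := by
  have hℓ : 4 ≤ ell D := by rw [ell]; exact hD
  have h1 : 1 ≤ ell D := by linarith
  have hD2 : 2 ≤ Real.log D := by linarith
  have hP : 1 < bigP D := by
    rw [bigP]; exact Real.one_lt_exp_iff.mpr (by positivity)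
  have hT1 : 1 ≤ bigT D := by rw [bigT]; exact Real.one_le_exp (Real.rpow_nonneg (by linarith) _)
  have hPT : Skeleton.P2 D ≤ bigP D / bigT D ^ 2 := (P2_le_P1 D).trans (P1_le_P_div_T_sq D hD2)
  have hlt : Skeleton.P2 D < bigP D :=
    lt_of_lt_of_le (lt_of_le_of_lt (P2_le_P1 D) (P1_lt_P_div_T_sq D hD2))
      (div_le_self (by linarith) (one_le_pow₀ hT1))
  -- log P₂ = 0.5𝓛⁹ − 10𝓛^{1.1} ≥ 0.498𝓛⁹ for 𝓛 ≥ 4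
  have hP0 : 0 < bigP D := Real.exp_pos _
  have hT0 : 0 < bigT D := Real.exp_pos _
  have e : Real.log (Skeleton.P2 D) = 0.5 * ell D ^ 9 - 10 * ell D ^ (1.1 : ℝ) := by
    rw [Skeleton.P2, Real.log_div (Real.rpow_pos_of_pos hP0 _).ne' (pow_pos hT0 _).ne',
      Real.log_rpow hP0, log_bigP, Real.log_pow, bigT, Real.log_exp]
    push_cast; ring
  have h2 : ell D ^ (1.1 : ℝ) ≤ ell D ^ 2 := by
    have := Real.rpow_le_rpow_of_exponent_le h1 (by norm_num : (1.1 : ℝ) ≤ 2)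
    rwa [Real.rpow_two] at this
  have h7 : (4:ℝ) ^ 7 ≤ ell D ^ 7 := pow_le_pow_left₀ (by norm_num) hℓ 7
  have h3 : 10 * ell D ^ 2 ≤ 0.002 * ell D ^ 9 := by
    rw [show ell D ^ 9 = ell D ^ 2 * ell D ^ 7 by ring]
    nlinarith [pow_nonneg (by linarith : (0:ℝ) ≤ ell D) 2]
  have hlo : 0.498 * ell D ^ 9 ≤ Real.log (Skeleton.P2 D) := by rw [e]; linarith
  have h9 : (4:ℝ) ^ 9 ≤ ell D ^ 9 := pow_le_pow_left₀ (by norm_num) hℓ 9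
  refine ⟨hP, hlt, hPT, ?_, hlo⟩
  nlinarith

variable (c' : ℝ)

/-- **`Z22:§9.u002` at the strength the derivation gives** (the printed `O(𝓛⁻⁶)` of tex L2607 is
`O(𝓛⁻⁶)/log P₃ = O(𝓛⁻¹⁵)`, as §8 prints at tex L2422): from Lemma 8.2 at `x = P₃/(dr)`, `μ = 6`,
`Σ_m χ(m)ϰ₃(drm)m^{−(1−β_j)} = (L′(1,χ)/log P₃)𝔣_{j6}(P₃/dr) + O(𝓛⁻¹⁵)` for `dr < P₃/T` — the form the
§9 gathering (`Z22:§9.u004`) actually needs (main term `≍ L′/log P₃ ≍ 𝓛⁻⁷`).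
[cite: Zhang2022LandauSiegel, §9 p.51, tex L2605–L2608; §8 p.47, tex L2420–L2427] -/
theorem step9u002_sharp :
    Skeleton.Lemma82 c' → ∃ C : ℝ, ForAllLarge fun D _ χ => AssumptionA D χ →
      ∀ j ∈ ({1, 2, 3} : Finset ℕ), ∀ d r : ℕ, 1 ≤ d → 1 ≤ r →
        ((d * r : ℕ) : ℝ) < P3 D / bigT D →
          ‖(∑ m ∈ Finset.Ico 1 (Nsupp D),
                χ (m : ZMod D) * vk3 D (d * r * m) / (m : ℂ) ^ (1 - betaJ c' D j)) -
              deriv χ.LFunction 1 / (Real.log (P3 D) : ℂ) *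
                frakfW c' D j 6 (P3 D / ((d * r : ℕ) : ℝ))‖ ≤ C * (ell D ^ 15)⁻¹ := by
  rintro ⟨C, hC⟩
  refine ⟨3 * max C 0, ?_⟩
  refine (hC.and (forAllLarge_log_ge'' 2)).mono ?_
  intro D _ χ _ _ ⟨H82, HL⟩ hA j hj d r hd hr hdr
  obtain ⟨hP1, hP3P, hP3T, hlog1⟩ := P3_facts' (D := D) HL
  have hP3pos : 0 < P3 D := (P2_pos_P3_pos' D).2
  have hdr0 : 0 < ((d * r : ℕ) : ℝ) := by
    have : 1 ≤ d * r := Nat.one_le_iff_ne_zero.mpr (Nat.mul_ne_zero (by omega) (by omega))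
    exact_mod_cast this
  set y : ℝ := P3 D / ((d * r : ℕ) : ℝ) with hy
  have hTy : bigT D < y := by
    rw [hy, lt_div_iff₀ hdr0, mul_comm]; rwa [lt_div_iff₀ (bigT_pos' D)] at hdr
  have hyP3 : y ≤ P3 D := by
    rw [hy]; refine div_le_self hP3pos.le ?_
    have : 1 ≤ d * r := Nat.one_le_iff_ne_zero.mpr (Nat.mul_ne_zero (by omega) (by omega))
    exact_mod_cast this
  have hyP : y < bigP D := lt_of_le_of_lt hyP3 hP3P
  have key := H82 hA j hj 6 (by simp) y hTy hyP
  have hlogne : Real.log (P3 D) ≠ 0 := by linarith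
  -- truncation: the `m`-sum of `S_j` over `Ico 1 (Nsupp D)` equals the sum over `Ico 1 ⌈y⌉₊`
  have hceil : ⌈y⌉₊ ≤ Nsupp D := Nat.ceil_mono (hyP3.trans hP3T)
  have hsub : Finset.Ico 1 ⌈y⌉₊ ⊆ Finset.Ico 1 (Nsupp D) := Finset.Ico_subset_Ico_right hceil
  have hzero : ∀ m ∈ Finset.Ico 1 (Nsupp D), m ∉ Finset.Ico 1 ⌈y⌉₊ →
      χ (m : ZMod D) * vk3 D (d * r * m) / (m : ℂ) ^ (1 - betaJ c' D j) = 0 := by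
    intro m hm hm'
    rw [Finset.mem_Ico] at hm
    rw [Finset.mem_Ico, not_and, not_lt] at hm'
    have hym : y ≤ m := Nat.ceil_le.mp (hm' hm.1)
    have hge : ¬ ((d * r * m : ℕ) : ℝ) < P3 D := by
      rw [not_lt]
      have e1 : P3 D = y * ((d * r : ℕ) : ℝ) := by rw [hy, div_mul_cancel₀ _ hdr0.ne']
      have e2 : ((d * r * m : ℕ) : ℝ) = (m : ℝ) * ((d * r : ℕ) : ℝ) := by push_cast; ring
      rw [e1, e2]
      exact mul_le_mul_of_nonneg_right hym hdr0.le
    rw [vk3, if_neg hge]; simp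
  rw [← Finset.sum_subset hsub hzero]
  -- summand identity
  have hterm : ∀ m ∈ Finset.Ico 1 ⌈y⌉₊,
      χ (m : ZMod D) * vk3 D (d * r * m) / (m : ℂ) ^ (1 - betaJ c' D j) =
        (Real.log (P3 D) : ℂ)⁻¹ *
          (χ (m : ZMod D) / (m : ℂ) ^ (1 - betaJ c' D j) * ((y / m : ℝ) : ℂ) ^ betaMu D 6 *
            (Real.log (y / m) : ℂ)) := by
    intro m hm
    rw [Finset.mem_Ico] at hm
    have hmy : (m : ℝ) < y := Nat.lt_ceil.mp hm.2
    exact vk3_summand_eq c' χ j hdr0 hm.1 hlogne hmy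
  rw [Finset.sum_congr rfl hterm, ← Finset.mul_sum]
  have hL : (Real.log (P3 D) : ℂ) ≠ 0 := by exact_mod_cast hlogne
  have e : (Real.log (P3 D) : ℂ)⁻¹ *
        (∑ m ∈ Finset.Ico 1 ⌈y⌉₊, χ (m : ZMod D) / (m : ℂ) ^ (1 - betaJ c' D j) *
          ((y / m : ℝ) : ℂ) ^ betaMu D 6 * (Real.log (y / m) : ℂ)) -
        deriv χ.LFunction 1 / (Real.log (P3 D) : ℂ) * frakfW c' D j 6 y =
      (Real.log (P3 D) : ℂ)⁻¹ *
        ((∑ m ∈ Finset.Ico 1 ⌈y⌉₊, χ (m : ZMod D) / (m : ℂ) ^ (1 - betaJ c' D j) *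
          ((y / m : ℝ) : ℂ) ^ betaMu D 6 * (Real.log (y / m) : ℂ)) -
          deriv χ.LFunction 1 * frakfW c' D j 6 y) := by
    field_simp
  rw [e, norm_mul, norm_inv, Complex.norm_real, Real.norm_eq_abs, abs_of_pos (by linarith)]
  calc (Real.log (P3 D))⁻¹ * ‖(∑ m ∈ Finset.Ico 1 ⌈y⌉₊, χ (m : ZMod D) / (m : ℂ) ^ (1 - betaJ c' D j) *
          ((y / m : ℝ) : ℂ) ^ betaMu D 6 * (Real.log (y / m) : ℂ)) - deriv χ.LFunction 1 * frakfW c' D j 6 y‖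
      ≤ (Real.log (P3 D))⁻¹ * (max C 0 * (ell D ^ 6)⁻¹) := by
        have hℓ : 0 < ell D := by rw [ell]; linarith
        refine mul_le_mul_of_nonneg_left (key.trans ?_) (inv_nonneg.mpr (by linarith))
        exact mul_le_mul_of_nonneg_right (le_max_left _ _) (by positivity)
    _ = (max C 0 / 0.498) * (ell D ^ 15)⁻¹ := by
        have hℓ : 0 < ell D := by rw [ell]; linarith
        rw [log_P3']; field_simp
    _ ≤ 3 * max C 0 * (ell D ^ 15)⁻¹ := by
        have hℓ : 0 < ell D := by rw [ell]; linarith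
        have h0 : 0 ≤ max C 0 := le_max_right _ _
        have : max C 0 / 0.498 ≤ 3 * max C 0 := by
          rw [div_le_iff₀ (by norm_num)]; nlinarith
        exact mul_le_mul_of_nonneg_right this (by positivity)


/-- **`Z22:§9.u003` at strength `O(𝓛⁻¹⁵)`**: from Lemma 8.4 at `x = P₃/(dr)`, `μ = 6`,
`Σ_n χ(n)ϰ̄₃(drn)ξ₀ⱼ(n;d,r)/n = (L′(1,χ)Π(d,r)/log P₃)𝔤_{j6}(P₃/dr) + O(𝓛⁻¹⁵)` for `dr < P₃/T`.
[cite: Zhang2022LandauSiegel, §9 p.51, tex L2609–L2612; §8 p.47, tex L2428–L2435] -/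
theorem step9u003_sharp :
    Skeleton.Lemma84 c' → ∃ C : ℝ, ForAllLarge fun D _ χ => AssumptionA D χ →
      ∀ j ∈ ({1, 2, 3} : Finset ℕ), ∀ d r : ℕ, 1 ≤ d → 1 ≤ r →
        ((d * r : ℕ) : ℝ) < P3 D / bigT D →
          ‖(∑ n ∈ Finset.Ico 1 (Nsupp D),
                χ (n : ZMod D) * conj (vk3 D (d * r * n)) * xiZero c' D j n d r / (n : ℂ)) -
              deriv χ.LFunction 1 * PiW χ d r / (Real.log (P3 D) : ℂ) *
                frakgW c' D j 6 (P3 D / ((d * r : ℕ) : ℝ))‖ ≤ C * (ell D ^ 15)⁻¹ := by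
  rintro ⟨C, hC⟩
  refine ⟨3 * max C 0, ?_⟩
  refine (hC.and (forAllLarge_log_ge'' 2)).mono ?_
  intro D _ χ _ _ ⟨H84, HL⟩ hA j hj d r hd hr hdr
  obtain ⟨hP1, hP3P, hP3T, hlog1⟩ := P3_facts' (D := D) HL
  have hP3pos : 0 < P3 D := (P2_pos_P3_pos' D).2
  have hdr1 : 1 ≤ d * r := Nat.one_le_iff_ne_zero.mpr (Nat.mul_ne_zero (by omega) (by omega))
  have hdr0 : 0 < ((d * r : ℕ) : ℝ) := by exact_mod_cast hdr1
  set y : ℝ := P3 D / ((d * r : ℕ) : ℝ) with hy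
  have hT1 : 1 ≤ bigT D := by rw [bigT]; exact Real.one_le_exp (Real.rpow_nonneg (by rw [ell]; positivity) _)
  have hTy : bigT D < y := by
    rw [hy, lt_div_iff₀ hdr0, mul_comm]; rwa [lt_div_iff₀ (bigT_pos' D)] at hdr
  have hyP3 : y ≤ P3 D := by
    rw [hy]; exact div_le_self hP3pos.le (by exact_mod_cast hdr1)
  have hyP : y < bigP D := lt_of_le_of_lt hyP3 hP3P
  have hdrPT : ((d * r : ℕ) : ℝ) < bigP D / bigT D ^ 2 := by
    have h1 : P3 D / bigT D ≤ P3 D := div_le_self hP3pos.le hT1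
    linarith
  have key := H84 hA j hj 6 (by simp) d r hd hr hdrPT y hTy hyP
  have hlogne : Real.log (P3 D) ≠ 0 := by linarith
  have hceil : ⌈y⌉₊ ≤ Nsupp D := Nat.ceil_mono (hyP3.trans hP3T)
  have hsub : Finset.Ico 1 ⌈y⌉₊ ⊆ Finset.Ico 1 (Nsupp D) := Finset.Ico_subset_Ico_right hceil
  have hzero : ∀ n ∈ Finset.Ico 1 (Nsupp D), n ∉ Finset.Ico 1 ⌈y⌉₊ →
      χ (n : ZMod D) * conj (vk3 D (d * r * n)) * xiZero c' D j n d r / (n : ℂ) = 0 := by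
    intro n hn hn'
    rw [Finset.mem_Ico] at hn
    rw [Finset.mem_Ico, not_and, not_lt] at hn'
    have hyn : y ≤ n := Nat.ceil_le.mp (hn' hn.1)
    have hge : ¬ ((d * r * n : ℕ) : ℝ) < P3 D := by
      rw [not_lt]
      have e1 : P3 D = y * ((d * r : ℕ) : ℝ) := by rw [hy, div_mul_cancel₀ _ hdr0.ne']
      have e2 : ((d * r * n : ℕ) : ℝ) = (n : ℝ) * ((d * r : ℕ) : ℝ) := by push_cast; ring
      rw [e1, e2]
      exact mul_le_mul_of_nonneg_right hyn hdr0.le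
    rw [vk3, if_neg hge]; simp
  rw [← Finset.sum_subset hsub hzero]
  have hterm : ∀ n ∈ Finset.Ico 1 ⌈y⌉₊,
      χ (n : ZMod D) * conj (vk3 D (d * r * n)) * xiZero c' D j n d r / (n : ℂ) =
        (Real.log (P3 D) : ℂ)⁻¹ *
          (χ (n : ZMod D) * xiZero c' D j n d r / (n : ℂ) * ((y / n : ℝ) : ℂ) ^ (-betaMu D 6) *
            (Real.log (y / n) : ℂ)) := by
    intro n hn
    rw [Finset.mem_Ico] at hn
    exact conj_vk3_summand_eq c' χ j hdr0 hn.1 hlogne (Nat.lt_ceil.mp hn.2)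
  rw [Finset.sum_congr rfl hterm, ← Finset.mul_sum]
  have hL : (Real.log (P3 D) : ℂ) ≠ 0 := by exact_mod_cast hlogne
  have e : (Real.log (P3 D) : ℂ)⁻¹ *
        (∑ n ∈ Finset.Ico 1 ⌈y⌉₊, χ (n : ZMod D) * xiZero c' D j n d r / (n : ℂ) *
          ((y / n : ℝ) : ℂ) ^ (-betaMu D 6) * (Real.log (y / n) : ℂ)) -
        deriv χ.LFunction 1 * PiW χ d r / (Real.log (P3 D) : ℂ) * frakgW c' D j 6 y =
      (Real.log (P3 D) : ℂ)⁻¹ *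
        ((∑ n ∈ Finset.Ico 1 ⌈y⌉₊, χ (n : ZMod D) * xiZero c' D j n d r / (n : ℂ) *
          ((y / n : ℝ) : ℂ) ^ (-betaMu D 6) * (Real.log (y / n) : ℂ)) -
          deriv χ.LFunction 1 * PiW χ d r * frakgW c' D j 6 y) := by
    field_simp
  rw [e, norm_mul, norm_inv, Complex.norm_real, Real.norm_eq_abs, abs_of_pos (by linarith)]
  calc (Real.log (P3 D))⁻¹ * ‖(∑ n ∈ Finset.Ico 1 ⌈y⌉₊, χ (n : ZMod D) * xiZero c' D j n d r / (n : ℂ) *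
          ((y / n : ℝ) : ℂ) ^ (-betaMu D 6) * (Real.log (y / n) : ℂ)) -
          deriv χ.LFunction 1 * PiW χ d r * frakgW c' D j 6 y‖
      ≤ (Real.log (P3 D))⁻¹ * (max C 0 * (ell D ^ 6)⁻¹) := by
        have hℓ : 0 < ell D := by rw [ell]; linarith
        refine mul_le_mul_of_nonneg_left (key.trans ?_) (inv_nonneg.mpr (by linarith))
        exact mul_le_mul_of_nonneg_right (le_max_left _ _) (by positivity)
    _ = (max C 0 / 0.498) * (ell D ^ 15)⁻¹ := by
        have hℓ : 0 < ell D := by rw [ell]; linarith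
        rw [log_P3']; field_simp
    _ ≤ 3 * max C 0 * (ell D ^ 15)⁻¹ := by
        have hℓ : 0 < ell D := by rw [ell]; linarith
        have h0 : 0 ≤ max C 0 := le_max_right _ _
        have : max C 0 / 0.498 ≤ 3 * max C 0 := by
          rw [div_le_iff₀ (by norm_num)]; nlinarith
        exact mul_le_mul_of_nonneg_right this (by positivity)


/-- **`Z22:§8.u041` as an implication from the banked Lemma 8.2, for EVERY `c′`** (d20's
`Section8FrontEnd82.step8u041_holds` proves the node outright for `c′ ≥ 0` via `lemma82_holds`; the
implication form is what composes with the cone's hypothesis `Lemma82 c′` and is also the `ϰ₂`-input of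
the §9 gathering `Z22:§9.u004`): `Σ_m χ(m)ϰ₂(drm)m^{−(1−β_j)} = (L′(1,χ)/log P₂)𝔣_{j7}(P₂/dr) + O(𝓛⁻¹⁵)`
for `dr < P₂/T` — Lemma 8.2 at `x = P₂/(dr)`, `μ = 7`, divided by `log P₂ ≥ 0.498𝓛⁹`.
[cite: Zhang2022LandauSiegel, §8 p.47, tex L2424–L2427; §9 p.51] -/
theorem step8u041_of_lemma82 :
    Skeleton.Lemma82 c' → Section8cStatements.Step8u041 c' := by
  rintro ⟨C, hC⟩
  refine ⟨3 * max C 0, ?_⟩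
  refine (hC.and (forAllLarge_log_ge'' 4)).mono ?_
  intro D _ χ _ _ ⟨H82, HL⟩ hA j hj d r hd hr hdr
  obtain ⟨hP1, hP3P, hP3T, hlog1, hlogP2⟩ := P2_facts' (D := D) HL
  have hP3pos : 0 < Skeleton.P2 D := (P2_pos_P3_pos' D).1
  have hdr0 : 0 < ((d * r : ℕ) : ℝ) := by
    have : 1 ≤ d * r := Nat.one_le_iff_ne_zero.mpr (Nat.mul_ne_zero (by omega) (by omega))
    exact_mod_cast this
  set y : ℝ := Skeleton.P2 D / ((d * r : ℕ) : ℝ) with hy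
  have hTy : bigT D < y := by
    rw [hy, lt_div_iff₀ hdr0, mul_comm]; rwa [lt_div_iff₀ (bigT_pos' D)] at hdr
  have hyP3 : y ≤ Skeleton.P2 D := by
    rw [hy]; refine div_le_self hP3pos.le ?_
    have : 1 ≤ d * r := Nat.one_le_iff_ne_zero.mpr (Nat.mul_ne_zero (by omega) (by omega))
    exact_mod_cast this
  have hyP : y < bigP D := lt_of_le_of_lt hyP3 hP3P
  have key := H82 hA j hj 7 (by simp) y hTy hyP
  have hlogne : Real.log (Skeleton.P2 D) ≠ 0 := by linarith
  -- truncation: the `m`-sum of `S_j` over `Ico 1 (Nsupp D)` equals the sum over `Ico 1 ⌈y⌉₊`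
  have hceil : ⌈y⌉₊ ≤ Nsupp D := Nat.ceil_mono (hyP3.trans hP3T)
  have hsub : Finset.Ico 1 ⌈y⌉₊ ⊆ Finset.Ico 1 (Nsupp D) := Finset.Ico_subset_Ico_right hceil
  have hzero : ∀ m ∈ Finset.Ico 1 (Nsupp D), m ∉ Finset.Ico 1 ⌈y⌉₊ →
      χ (m : ZMod D) * vk2 D (d * r * m) / (m : ℂ) ^ (1 - betaJ c' D j) = 0 := by
    intro m hm hm'
    rw [Finset.mem_Ico] at hm
    rw [Finset.mem_Ico, not_and, not_lt] at hm'
    have hym : y ≤ m := Nat.ceil_le.mp (hm' hm.1)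
    have hge : ¬ ((d * r * m : ℕ) : ℝ) < Skeleton.P2 D := by
      rw [not_lt]
      have e1 : Skeleton.P2 D = y * ((d * r : ℕ) : ℝ) := by rw [hy, div_mul_cancel₀ _ hdr0.ne']
      have e2 : ((d * r * m : ℕ) : ℝ) = (m : ℝ) * ((d * r : ℕ) : ℝ) := by push_cast; ring
      rw [e1, e2]
      exact mul_le_mul_of_nonneg_right hym hdr0.le
    rw [vk2, if_neg hge]; simp
  rw [← Finset.sum_subset hsub hzero]
  -- summand identity
  have hterm : ∀ m ∈ Finset.Ico 1 ⌈y⌉₊,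
      χ (m : ZMod D) * vk2 D (d * r * m) / (m : ℂ) ^ (1 - betaJ c' D j) =
        (Real.log (Skeleton.P2 D) : ℂ)⁻¹ *
          (χ (m : ZMod D) / (m : ℂ) ^ (1 - betaJ c' D j) * ((y / m : ℝ) : ℂ) ^ betaMu D 7 *
            (Real.log (y / m) : ℂ)) := by
    intro m hm
    rw [Finset.mem_Ico] at hm
    have hmy : (m : ℝ) < y := Nat.lt_ceil.mp hm.2
    exact vk2_summand_eq c' χ j hdr0 hm.1 hlogne hmy
  rw [Finset.sum_congr rfl hterm, ← Finset.mul_sum]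
  have hL : (Real.log (Skeleton.P2 D) : ℂ) ≠ 0 := by exact_mod_cast hlogne
  have e : (Real.log (Skeleton.P2 D) : ℂ)⁻¹ *
        (∑ m ∈ Finset.Ico 1 ⌈y⌉₊, χ (m : ZMod D) / (m : ℂ) ^ (1 - betaJ c' D j) *
          ((y / m : ℝ) : ℂ) ^ betaMu D 7 * (Real.log (y / m) : ℂ)) -
        deriv χ.LFunction 1 / (Real.log (Skeleton.P2 D) : ℂ) * frakfW c' D j 7 y =
      (Real.log (Skeleton.P2 D) : ℂ)⁻¹ *
        ((∑ m ∈ Finset.Ico 1 ⌈y⌉₊, χ (m : ZMod D) / (m : ℂ) ^ (1 - betaJ c' D j) *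
          ((y / m : ℝ) : ℂ) ^ betaMu D 7 * (Real.log (y / m) : ℂ)) -
          deriv χ.LFunction 1 * frakfW c' D j 7 y) := by
    field_simp
  rw [e, norm_mul, norm_inv, Complex.norm_real, Real.norm_eq_abs, abs_of_pos (by linarith)]
  calc (Real.log (Skeleton.P2 D))⁻¹ * ‖(∑ m ∈ Finset.Ico 1 ⌈y⌉₊, χ (m : ZMod D) / (m : ℂ) ^ (1 - betaJ c' D j) *
          ((y / m : ℝ) : ℂ) ^ betaMu D 7 * (Real.log (y / m) : ℂ)) - deriv χ.LFunction 1 * frakfW c' D j 7 y‖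
      ≤ (Real.log (Skeleton.P2 D))⁻¹ * (max C 0 * (ell D ^ 6)⁻¹) := by
        have hℓ : 0 < ell D := by rw [ell]; linarith
        refine mul_le_mul_of_nonneg_left (key.trans ?_) (inv_nonneg.mpr (by linarith))
        exact mul_le_mul_of_nonneg_right (le_max_left _ _) (by positivity)
    _ ≤ (0.498 * ell D ^ 9)⁻¹ * (max C 0 * (ell D ^ 6)⁻¹) := by
        have hℓ : 0 < ell D := by rw [ell]; linarith
        refine mul_le_mul_of_nonneg_right ?_ (by positivity)
        exact inv_anti₀ (by positivity) hlogP2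
    _ = (max C 0 / 0.498) * (ell D ^ 15)⁻¹ := by
        have hℓ : 0 < ell D := by rw [ell]; linarith
        field_simp
    _ ≤ 3 * max C 0 * (ell D ^ 15)⁻¹ := by
        have hℓ : 0 < ell D := by rw [ell]; linarith
        have h0 : 0 ≤ max C 0 := le_max_right _ _
        have : max C 0 / 0.498 ≤ 3 * max C 0 := by
          rw [div_le_iff₀ (by norm_num)]; nlinarith
        exact mul_le_mul_of_nonneg_right this (by positivity)



end Literature.NumberTheory.LFunctions.Zhang2022.Section9Discharge

end
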